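import Literature.NumberTheory.EllipticCurves.PAdicDistributionModule
import HarnessLib

/-!
# The `M₂(ℤ_p)`-action and the weight (`Λ`-) action on `𝔻(ℤ_p × ℤ_p)`

`PAdicDistributionModule` lets INTEGER matrices act on the module `𝔻 = 𝔻(ℤ_p × ℤ_p)` of bounded
distributions (`actD`).  The Iwasawa-algebra structure of `𝔻` (Greenberg–Stevens 1993, §1: `ℤ_p^×`
acts on the vectors by homotheties, making `𝔻` a `ℤ_p⟦ℤ_p^×⟧`-module, and the weight-`n`
specialisation `𝔻 → Symⁿ` factors through `𝔻 ⊗_{Λ, t ↦ tⁿ} ℤ_p`) needs matrices with `p`-ADIC entries.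
This file provides them:

* `actDp a b c d : 𝔻 →ₗ[𝕜] 𝔻`, the right action of `(a b; c d) ∈ M₂(ℤ_p)` (push-forward along
  `(x, y) ↦ (a x + c y, b x + d y)`, `PAdicDistributionPushforward.linearCellMap`), a right action
  (`linearCellMap_mul`, `actDp_mul`, `actDp_one`) extending `actD` (`actD_eq_actDp`);
* its equivariance with the weight-`n` specialisation (`specializeₗ_actDp`:
  `specializeₗ n (μ·M) = Symⁿ(M) · specializeₗ n μ`);
* the **homotheties** `homothety t = actDp t 0 0 t` (`t ∈ ℤ_p`), which commute with every `actDp`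
  (`homothety_comm`) and on which **the weight-`n` specialisation has weight `n`**:
  `specializeₗ n (homothety t μ) = tⁿ • specializeₗ n μ` (`specializeₗ_homothety`) — so `specializeₗ n`
  kills `(homothety t − tⁿ) 𝔻`, i.e. factors through the weight-`n` quotient of the `Λ`-module `𝔻`
  (`specializeₗ_homothety_sub_pow_smul`).

Brick B2e of the bottom-up plan recorded with the named fact
`greenbergStevens_kitagawa_twoVariable_interpolation_allBranches`.  Everything is proved; no named facts.

## References

* R. Greenberg, G. Stevens, Invent. Math. 111 (1993), §1, §4. [GreenbergStevens1993]
-/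

noncomputable section

open Filter Topology Matrix

namespace Literature.NumberTheory.EllipticCurves

variable {p : ℕ} [Fact p.Prime]

/-! ### Composition of the level maps of `p`-adic matrices -/

/-- **The level maps compose like the matrices**: for `M = (a b; c d)`, `M' = (a' b'; c' d')`,
`(v·M)·M' = v·(M M')` modulo every `p^n`. [folklore] -/
theorem linearCellMap_mul (a b c d a' b' c' d' : ℤ_[p]) :
    ProfiniteTower.linearCellMap p (a * a' + b * c') (a * b' + b * d') (c * a' + d * c') (c * b' + d * d') =
      (ProfiniteTower.linearCellMap p a' b' c' d').comp (ProfiniteTower.linearCellMap p a b c d) := by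
  refine ProfiniteTower.CellMap.ext' fun n v => ?_
  rw [ProfiniteTower.CellMap.comp_map, ProfiniteTower.linearCellMap_map,
    ProfiniteTower.linearCellMap_map, ProfiniteTower.linearCellMap_map, linMapMod_apply,
    linMapMod_apply, linMapMod_apply]
  simp only [map_add, map_mul]
  refine Prod.ext ?_ ?_ <;> dsimp only <;> ring

/-- The identity matrix acts trivially. [folklore] -/
theorem linearCellMap_one :
    ProfiniteTower.linearCellMap p (1 : ℤ_[p]) 0 0 1 = ProfiniteTower.CellMap.id _ := by
  refine ProfiniteTower.CellMap.ext' fun n v => ?_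
  rw [ProfiniteTower.linearCellMap_map, linMapMod_apply, ProfiniteTower.CellMap.id_map]
  simp

/-! ### The action of `M₂(ℤ_p)` on `𝔻` -/

section Action

variable {𝕜 : Type*} [NormedField 𝕜] [IsUltrametricDist 𝕜]

variable (p 𝕜) in
/-- **The right action `μ ↦ μ·(a b; c d)` of `M₂(ℤ_p)` on `𝔻(ℤ_p × ℤ_p)`.**
[cite: GreenbergStevens1993, §1] -/
def actDp (a b c d : ℤ_[p]) : (padicIntSq p).distributions 𝕜 →ₗ[𝕜] (padicIntSq p).distributions 𝕜 :=
  ((ProfiniteTower.linearCellMap p a b c d).push 𝕜).restrict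
    fun _ hμ => ProfiniteTower.CellMap.push_mem _ hμ

/-- Unfolding lemma for `actDp`. [folklore] -/
@[simp] theorem coe_actDp (a b c d : ℤ_[p]) (μ : (padicIntSq p).distributions 𝕜) :
    ((actDp p 𝕜 a b c d μ : (padicIntSq p).distributions 𝕜) : (n : ℕ) → (padicIntSq p).Cell n → 𝕜) =
      (ProfiniteTower.linearCellMap p a b c d).push 𝕜 μ := rfl

/-- `actD` of an integer matrix is `actDp` of its entries. [folklore] -/
theorem actD_eq_actDp (M : Matrix (Fin 2) (Fin 2) ℤ) :
    actD p 𝕜 M = actDp p 𝕜 (M 0 0) (M 0 1) (M 1 0) (M 1 1) := rfl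

/-- **`actDp` is a right action.** [folklore] -/
theorem actDp_mul (a b c d a' b' c' d' : ℤ_[p]) :
    actDp p 𝕜 (a * a' + b * c') (a * b' + b * d') (c * a' + d * c') (c * b' + d * d') =
      (actDp p 𝕜 a' b' c' d').comp (actDp p 𝕜 a b c d) := by
  refine LinearMap.ext fun μ => Subtype.ext ?_
  rw [coe_actDp, LinearMap.comp_apply, coe_actDp, coe_actDp, linearCellMap_mul,
    ProfiniteTower.CellMap.push_comp, LinearMap.comp_apply]

/-- `actDp 1 0 0 1 = id`. [folklore] -/
@[simp] theorem actDp_one : actDp p 𝕜 (1 : ℤ_[p]) 0 0 1 = LinearMap.id := by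
  refine LinearMap.ext fun μ => Subtype.ext ?_
  rw [coe_actDp, linearCellMap_one, ProfiniteTower.CellMap.push_id]
  rfl

variable (p 𝕜) in
/-- **The homothety `μ ↦ μ·(t 0; 0 t)`**, `t ∈ ℤ_p` — for `t ∈ ℤ_p^×` this is the action through
which `𝔻` is a `ℤ_p⟦ℤ_p^×⟧`-module (Greenberg–Stevens 1993, §1). [cite: GreenbergStevens1993, §1] -/
def homothety (t : ℤ_[p]) : (padicIntSq p).distributions 𝕜 →ₗ[𝕜] (padicIntSq p).distributions 𝕜 :=
  actDp p 𝕜 t 0 0 t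

/-- Unfolding lemma for `homothety`. [folklore] -/
theorem homothety_def (t : ℤ_[p]) : homothety p 𝕜 t = actDp p 𝕜 t 0 0 t := rfl

/-- **Homotheties commute with every matrix.** [folklore] -/
theorem homothety_comm (t a b c d : ℤ_[p]) :
    (homothety p 𝕜 t).comp (actDp p 𝕜 a b c d) = (actDp p 𝕜 a b c d).comp (homothety p 𝕜 t) := by
  rw [homothety_def, ← actDp_mul, ← actDp_mul]
  congr 1 <;> ring

/-- Homotheties compose multiplicatively. [folklore] -/
theorem homothety_mul (t t' : ℤ_[p]) :
    homothety p 𝕜 (t * t') = (homothety p 𝕜 t').comp (homothety p 𝕜 t) := by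
  rw [homothety_def, homothety_def, homothety_def, ← actDp_mul]
  congr 1 <;> ring

/-- `homothety 1 = id`. [folklore] -/
@[simp] theorem homothety_one : homothety p 𝕜 (1 : ℤ_[p]) = LinearMap.id := by
  rw [homothety_def, actDp_one]

end Action

/-! ### Equivariance and weights of the specialisation -/

section Weight

/-- The level data of `toBounded (actDp a b c d μ)` are those of `(toBounded μ).linearMap a b c d`.
[folklore] -/
theorem toBounded_actDp_μ (a b c d : ℤ_[p]) (μ : (padicIntSq p).distributions ℚ_[p]) :
    (ProfiniteTower.toBounded (actDp p ℚ_[p] a b c d μ).2).μ =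
      ((ProfiniteTower.toBounded μ.2).linearMap a b c d).μ := rfl

/-- **Equivariance of the weight-`n` specialisation for `p`-adic matrices**:
`specializeₗ n (μ·M) = Symⁿ(M) · specializeₗ n μ`. [cite: GreenbergStevens1993, §4 (4.6)–(4.8)] -/
theorem specializeₗ_actDp (n : ℕ) (a b c d : ℤ_[p]) (μ : (padicIntSq p).distributions ℚ_[p]) :
    specializeₗ p n (actDp p ℚ_[p] a b c d μ) =
      ModularForms.HidaCohomology.symPow n (mat a b c d) *ᵥ specializeₗ p n μ := by
  rw [specializeₗ_apply, specializeₗ_apply,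
    BoundedDistribution.specialize_congr_μ (toBounded_actDp_μ a b c d μ) n,
    BoundedDistribution.specialize_linearMap]

/-- Binary forms of degree `n` are homogeneous of degree `n`: `F(t w) = tⁿ F(w)`. [folklore] -/
theorem evalVec_smul_arg {R : Type*} [CommRing R] (n : ℕ) (x : Fin (n + 1) → R) (t : R) (w : Fin 2 → R) :
    ModularForms.HidaCohomology.evalVec n x (t • w) = t ^ n * ModularForms.HidaCohomology.evalVec n x w := by
  simp only [ModularForms.HidaCohomology.evalVec, Pi.smul_apply, smul_eq_mul, Finset.mul_sum]
  refine Finset.sum_congr rfl fun i _ => ?_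
  have hi : (n - i) + (i : ℕ) = n := Nat.sub_add_cancel (Nat.lt_succ_iff.mp i.2)
  calc x i * (t * w 0) ^ (n - ↑i) * (t * w 1) ^ (i : ℕ)
      = t ^ ((n - i) + (i : ℕ)) * (x i * w 0 ^ (n - ↑i) * w 1 ^ (i : ℕ)) := by rw [pow_add]; ring
    _ = t ^ n * (x i * w 0 ^ (n - ↑i) * w 1 ^ (i : ℕ)) := by rw [hi]

/-- The scalar matrix acts on vectors by scalar multiplication. [folklore] -/
theorem mat_scalar_mulVec (t : ℤ_[p]) (w : Fin 2 → ℚ_[p]) : mat t 0 0 t *ᵥ w = (t : ℚ_[p]) • w := by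
  funext i
  fin_cases i
  · simp [mat_mulVec_zero]
  · simp [mat_mulVec_one]

/-- **The weight-`n` specialisation has weight `n` for the homotheties**:
`specializeₗ n (homothety t μ) = tⁿ • specializeₗ n μ` (`∫ P(t v) dμ = tⁿ ∫ P dμ` for `P` homogeneous
of degree `n`). [cite: GreenbergStevens1993, §1, §4] -/
theorem specializeₗ_homothety (n : ℕ) (t : ℤ_[p]) (μ : (padicIntSq p).distributions ℚ_[p]) :
    specializeₗ p n (homothety p ℚ_[p] t μ) = (t : ℚ_[p]) ^ n • specializeₗ p n μ := by
  rw [homothety_def]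
  refine BoundedDistribution.eq_of_evalVec_eq fun w => ?_
  rw [specializeₗ_apply, specializeₗ_apply,
    BoundedDistribution.specialize_congr_μ (toBounded_actDp_μ t 0 0 t μ) n,
    BoundedDistribution.evalVec_specialize_linearMap, mat_scalar_mulVec, evalVec_smul_arg,
    ModularForms.HidaCohomology.evalVec_smul]

/-- **The specialisation factors through the weight-`n` quotient**: it kills
`(homothety t − tⁿ)·μ` for every `t`. [folklore] -/
theorem specializeₗ_homothety_sub_pow_smul (n : ℕ) (t : ℤ_[p]) (μ : (padicIntSq p).distributions ℚ_[p]) :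
    specializeₗ p n (homothety p ℚ_[p] t μ - (t : ℚ_[p]) ^ n • μ) = 0 := by
  rw [map_sub, map_smul, specializeₗ_homothety, sub_self]

end Weight

end Literature.NumberTheory.EllipticCurves

end
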